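import Literature.NumberTheory.NumberFields.EquivariantUnramifiedDescent
import Mathlib.GroupTheory.Index
import Mathlib.GroupTheory.OrderOfElement
import Mathlib.Topology.Algebra.Group.ClosedSubgroup
import Mathlib.Topology.Algebra.Group.Pointwise
import HarnessLib

/-!
# Equivariant unramified descent, II: the combined statement, openness of the descent subgroup, and the
# existence of a totally ramified level (Washington §13.1 Lemma 13.3, §13.3 Lemmas 13.14–13.15)

Topic `NumberTheory/NumberFields` (namespace = path, grouping sub-namespace
`EquivariantUnramifiedDescent`).  THEOREM-ONLY file (no definition, no named fact, no `sorry`), sequel of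
`EquivariantUnramifiedDescent.lean` (notation as there), written by the literature seat
`bsd-potss-conjA-anchor` g17 (cell `bsd-potss`; serves the asides stmt-BirchSwinnertonDyer-19386 /
19413; closes nothing; neither Conjecture A nor BSD is proved for any curve here).

* `exists_equivariant_unramified_extension` — `exists_descentSubgroup` + `exists_hom_of_descentSubgroup`:
  an unramified `Γ`-equivariant exponent-`p` character `φ` of `H′ = Gal(k̄/L_∞)` extends, one layer above
  a totally ramified layer `n`, to an unramified `Γ`-equivariant character `ψ` of `Λ_{n+1} = Gal(k̄/L_{n+1})`
  with kernel `Q = (I_{i₀} ∩ Λ_{n+1}) · ker φ`.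
* `isOpen_of_eq_mul_of_ker` — topological supplement: in a compact topological group, a subgroup
  `Q ≤ Λ′` which is (as a set) a product `S · T` of a compact and a closed set, and is the kernel in the
  finite-index `Λ′` of an additive map to a FINITE group, is OPEN (closed of finite index,
  `Subgroup.isOpen_of_isClosed_of_finiteIndex`).  For the descent subgroup: `S = I_{i₀} ∩ Λ_{n+1}`,
  `T = ker φ`; so `ψ` is continuous and factors through a finite quotient `Gal(F/k)`.
* `exists_level_totallyRamified` — Washington Lemma 13.3 in this language: if `Λ₀` has finite index,
  `κ(I_{i₀}) = ℤ_p` and every `p`-adic `I_i` is a conjugate of `I_{i₀}`, then there is `e` with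
  `κ(I_i ∩ Λ₀) ⊇ pⁿℤ_p` for all `n ≥ e` and all `p`-adic `i` (the hypothesis `hram` of the descent).

HONEST FRAMING: lemmas of group theory / point-set topology; the cites record the printed argument
they transcribe.

## References

* L. C. Washington, *Introduction to Cyclotomic Fields*, 2nd ed., GTM 83 (1997), §13.1 Prop. 13.2 and
  Lemma 13.3; §13.3 Lemmas 13.14–13.15. [Washington1997]
* J. Coates, R. Sujatha, *Fine Selmer groups of elliptic curves over `p`-adic Lie extensions*,
  Math. Ann. 331 (2005), §3 Thm. 3.4. [CoatesSujatha2005]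
-/

open scoped Pointwise

namespace Literature.NumberTheory.NumberFields

namespace EquivariantUnramifiedDescent

section Algebra

variable {Γ : Type*} [Group Γ] {p : ℕ} [hp : Fact p.Prime]

/-- **Equivariant unramified descent** (`exists_descentSubgroup` + `exists_hom_of_descentSubgroup`):
in the situation of `exists_descentSubgroup`, the unramified `Γ`-equivariant character `φ` of
`H′ = Gal(k̄/L_∞)` EXTENDS to a `Γ`-equivariant additive character `ψ` of `Λ_{n+1} = Gal(k̄/L_{n+1})`
killing EVERY `I_i ∩ Λ_{n+1}` («unramified everywhere»), whose kernel on `Λ_{n+1}` is the descent subgroup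
`Q = (I_{i₀} ∩ Λ_{n+1}) · ker φ`.  In particular `ψ ≠ 0` as soon as `φ ≠ 0`.
[cite: Washington1997, §13.3 Lemmas 13.14–13.15, §13.1 Prop. 13.2]
[cite: CoatesSujatha2005, §3 Thm. 3.4 (proof: descent of `Y(E/L_∞)` to the finite layers)] -/
theorem exists_equivariant_unramified_extension (κ : Γ →* Multiplicative ℤ_[p]) (Λ₀ : Subgroup Γ)
    [Λ₀.Normal] (H' : Subgroup Γ) (hH' : ∀ σ, σ ∈ H' ↔ σ ∈ Λ₀ ∧ κ σ = 1)
    (Λ : ℕ → Subgroup Γ) (hΛ : ∀ m σ, σ ∈ Λ m ↔ σ ∈ Λ₀ ∧ (p : ℤ_[p]) ^ m ∣ (κ σ).toAdd)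
    {V : Type*} [AddCommGroup V] [DistribMulAction Γ V]
    (hpV : ∀ v : V, p • v = 0) (htriv : ∀ σ ∈ Λ₀, ∀ v : V, σ • v = v)
    {ι : Type*} (I : ι → Subgroup Γ) (pAdic : ι → Prop) (i₀ : ι) (hi₀ : pAdic i₀)
    (hconj : ∀ g : Γ, ∃ j, pAdic j ∧ ∀ x, x ∈ I j ↔ g⁻¹ * x * g ∈ I i₀)
    (hIker : ∀ i, ¬ pAdic i → ∀ x ∈ I i, κ x = 1)
    (n : ℕ)
    (hram : ∀ i, pAdic i → ∀ t : ℤ_[p], (p : ℤ_[p]) ^ n ∣ t →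
      ∃ y ∈ I i, y ∈ Λ₀ ∧ (κ y).toAdd = t)
    (φ : Γ → V) (hφ_mul : ∀ a ∈ H', ∀ b ∈ H', φ (a * b) = φ a + φ b)
    (hφ_equiv : ∀ (g : Γ), ∀ τ ∈ H', φ (g * τ * g⁻¹) = g • φ τ)
    (hφ_I : ∀ i, ∀ τ ∈ I i, τ ∈ H' → φ τ = 0) :
    ∃ (Q : Subgroup Γ) (ψ : Γ → V),
      (∀ x, x ∈ Q ↔ ∃ y ∈ I i₀, ∃ k ∈ H', y ∈ Λ (n + 1) ∧ φ k = 0 ∧ y * k = x) ∧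
      Q ≤ Λ (n + 1) ∧ (∀ (g : Γ), ∀ x ∈ Q, g * x * g⁻¹ ∈ Q) ∧
      (∀ τ ∈ H', ψ τ = φ τ) ∧
      (∀ a ∈ Λ (n + 1), ∀ b ∈ Λ (n + 1), ψ (a * b) = ψ a + ψ b) ∧
      (∀ (g : Γ), ∀ σ ∈ Λ (n + 1), ψ (g * σ * g⁻¹) = g • ψ σ) ∧
      (∀ i, ∀ σ ∈ I i, σ ∈ Λ (n + 1) → ψ σ = 0) ∧
      (∀ σ ∈ Λ (n + 1), ψ σ = 0 ↔ σ ∈ Q) ∧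
      (∀ σ, σ ∉ Λ (n + 1) → ψ σ = 0) := by
  obtain ⟨Q, hQmem, hQle, hQn, hQI, hQH, hdec⟩ := exists_descentSubgroup κ Λ₀ H' hH' Λ hΛ hpV htriv
    I pAdic i₀ hi₀ hconj hIker n hram φ hφ_mul hφ_equiv hφ_I
  have hκconj : ∀ g x : Γ, κ (g * x * g⁻¹) = κ x := fun g x => by
    rw [map_mul, map_mul, map_inv, mul_comm (κ g) (κ x), mul_assoc, mul_inv_cancel, mul_one]
  have hH'n : ∀ (g : Γ), ∀ x ∈ H', g * x * g⁻¹ ∈ H' := fun g x hx => by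
    rw [hH'] at hx ⊢
    exact ⟨Subgroup.Normal.conj_mem inferInstance x hx.1 g, by rw [hκconj, hx.2]⟩
  have hΛn : ∀ (g : Γ), ∀ x ∈ Λ (n + 1), g * x * g⁻¹ ∈ Λ (n + 1) := fun g x hx => by
    rw [hΛ] at hx ⊢
    exact ⟨Subgroup.Normal.conj_mem inferInstance x hx.1 g, by rw [hκconj]; exact hx.2⟩
  have hH'Λ : H' ≤ Λ (n + 1) := fun x hx => by
    rw [hH'] at hx
    rw [hΛ]
    exact ⟨hx.1, by rw [hx.2, toAdd_one]; exact dvd_zero _⟩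
  have htriv' : ∀ σ ∈ Λ (n + 1), ∀ v : V, σ • v = v := fun σ hσ => htriv σ ((hΛ _ σ).1 hσ).1
  obtain ⟨ψ, hψφ, -, hψmul, hψeq, hψker, hψoff⟩ := exists_hom_of_descentSubgroup H' (Λ (n + 1)) Q
    hH'n hΛn hQn hH'Λ hQle htriv' φ hφ_mul hφ_equiv hQH hdec
  exact ⟨Q, ψ, hQmem, hQle, hQn, hψφ, hψmul, hψeq,
    fun i σ hσI hσΛ => (hψker σ hσΛ).2 (hQI i σ hσI hσΛ), hψker, hψoff⟩


end Algebra

section Level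

variable {Γ : Type*} [Group Γ] {p : ℕ} [hp : Fact p.Prime]

/-- **A totally ramified level exists** (Washington Lemma 13.3: in a `ℤ_p`-extension all primes above
`p` are totally ramified from some layer on), group-theoretically: if `Λ₀ ⊴ Γ` has finite index,
`κ(I_{i₀}) = ℤ_p` («`p` is totally ramified in `k_∞/k`») and every `p`-adic `I_i` is a conjugate of
`I_{i₀}`, then for some `e` and every `n ≥ e`, `pⁿℤ_p ⊆ κ(I_i ∩ Λ₀)` for every `p`-adic `i` — the
hypothesis `hram` of `exists_descentSubgroup`.  (Index `m = [I_{i₀} : I_{i₀} ∩ Λ₀]` kills `I_{i₀}`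
into `Λ₀`, so `mℤ_p = p^{v_p(m)}ℤ_p ⊆ κ(I_{i₀} ∩ Λ₀)`; conjugation does not change `κ`.)
[cite: Washington1997, §13.1 Lemma 13.3] -/
theorem exists_level_totallyRamified (κ : Γ →* Multiplicative ℤ_[p]) (Λ₀ : Subgroup Γ) [Λ₀.Normal]
    [Λ₀.FiniteIndex] {ι : Type*} (I : ι → Subgroup Γ) (pAdic : ι → Prop) (i₀ : ι)
    (htrans : ∀ i, pAdic i → ∃ g : Γ, ∀ x, x ∈ I i ↔ g⁻¹ * x * g ∈ I i₀)
    (hsurj : ∀ t : ℤ_[p], ∃ y ∈ I i₀, (κ y).toAdd = t) :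
    ∃ e : ℕ, ∀ n, e ≤ n → ∀ i, pAdic i → ∀ t : ℤ_[p], (p : ℤ_[p]) ^ n ∣ t →
      ∃ y ∈ I i, y ∈ Λ₀ ∧ (κ y).toAdd = t := by
  classical
  -- the index `m` of `Λ₀ ∩ I_{i₀}` in `I_{i₀}` is non-zero and kills `I_{i₀}` into `Λ₀`
  set m : ℕ := Λ₀.relIndex (I i₀) with hm
  have hm0 : m ≠ 0 := by
    intro h0
    have hdvd : m ∣ Λ₀.index := Subgroup.relIndex_dvd_index_of_normal Λ₀ (I i₀)
    rw [h0, zero_dvd_iff] at hdvd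
    exact Subgroup.FiniteIndex.index_ne_zero hdvd
  have hpow : ∀ y ∈ I i₀, y ^ m ∈ Λ₀ := fun y hy => Subgroup.pow_relIndex_mem Λ₀ hy
  -- `m = u · p^e` in `ℤ_p`
  have hmZ : (m : ℤ_[p]) ≠ 0 := Nat.cast_ne_zero.2 hm0
  set e : ℕ := (m : ℤ_[p]).valuation with he
  refine ⟨e, fun n hn i hi t ht => ?_⟩
  -- first for `i₀`: every `t ∈ p^e ℤ_p` is `κ` of an element of `I_{i₀} ∩ Λ₀`
  have base : ∀ t : ℤ_[p], (p : ℤ_[p]) ^ e ∣ t → ∃ y ∈ I i₀, y ∈ Λ₀ ∧ (κ y).toAdd = t := by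
    intro t ht
    obtain ⟨r, hr⟩ := ht
    -- `t = p^e r = m · (u⁻¹ r)`
    obtain ⟨u, hmu⟩ : ∃ u : ℤ_[p]ˣ, (m : ℤ_[p]) = (u : ℤ_[p]) * (p : ℤ_[p]) ^ e :=
      ⟨_, PadicInt.unitCoeff_spec hmZ⟩
    obtain ⟨y, hy, hyt⟩ := hsurj (((u⁻¹ : ℤ_[p]ˣ) : ℤ_[p]) * r)
    refine ⟨y ^ m, (I i₀).pow_mem hy m, hpow y hy, ?_⟩
    rw [map_pow, toAdd_pow, hyt, nsmul_eq_mul, hmu, hr]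
    calc (u : ℤ_[p]) * (p : ℤ_[p]) ^ e * (((u⁻¹ : ℤ_[p]ˣ) : ℤ_[p]) * r)
        = ((u : ℤ_[p]) * ((u⁻¹ : ℤ_[p]ˣ) : ℤ_[p])) * ((p : ℤ_[p]) ^ e * r) := by ring
      _ = (p : ℤ_[p]) ^ e * r := by rw [Units.mul_inv, one_mul]
  -- then transport by conjugation to any `p`-adic `i`
  have ht' : (p : ℤ_[p]) ^ e ∣ t := (pow_dvd_pow (p : ℤ_[p]) hn).trans ht
  obtain ⟨y₀, hy₀I, hy₀Λ, hy₀t⟩ := base t ht'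
  obtain ⟨g, hg⟩ := htrans i hi
  refine ⟨g * y₀ * g⁻¹, (hg _).2 ?_, Subgroup.Normal.conj_mem inferInstance y₀ hy₀Λ g, ?_⟩
  · have : g⁻¹ * (g * y₀ * g⁻¹) * g = y₀ := by group
    rw [this]; exact hy₀I
  · have hc : κ (g * y₀ * g⁻¹) = κ y₀ := by
      rw [map_mul, map_mul, map_inv, mul_comm (κ g) (κ y₀), mul_assoc, mul_inv_cancel, mul_one]
    rw [hc, hy₀t]

end Level

section Topology

variable {Γ : Type*} [Group Γ] [TopologicalSpace Γ] [IsTopologicalGroup Γ]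

/-- **The descent subgroup is open.**  In a topological group, let `Q ≤ Λ′` be subgroups with
`Λ′` of finite index, `Q = S · T` as sets with `S` compact and `T` closed (for the descent subgroup:
`S = I_{i₀} ∩ Λ_{n+1}`, `T = ker φ`), and suppose `Q` is the kernel inside `Λ′` of a map `ψ` to a
FINITE group which is additive on `Λ′` (the extended character).  Then `Q` is closed of finite index,
hence OPEN — so `ψ` is continuous and factors through a finite quotient of `Γ`.
[cite: Washington1997, §13.3 Lemma 13.15 (`X/ν_{n,e}Y_e ≅ A_n` is finite)] -/
theorem isOpen_of_eq_mul_of_ker (Q Λ' : Subgroup Γ) (hQΛ' : Q ≤ Λ') [Λ'.FiniteIndex]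
    (S T : Set Γ) (hS : IsCompact S) (hT : IsClosed T) (hQST : (Q : Set Γ) = S * T)
    {V : Type*} [AddCommGroup V] [Finite V] (ψ : Γ → V)
    (hψmul : ∀ a ∈ Λ', ∀ b ∈ Λ', ψ (a * b) = ψ a + ψ b) (hψker : ∀ σ ∈ Λ', ψ σ = 0 ↔ σ ∈ Q) :
    IsOpen (Q : Set Γ) := by
  classical
  have hclosed : IsClosed (Q : Set Γ) := by
    rw [hQST]; exact hT.mul_left_of_isCompact hS
  -- `ψ` restricted to `Λ′` is a homomorphism to the finite group `V`, with kernel `Q ∩ Λ′ = Q`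
  have hψ1 : ψ 1 = 0 := by
    have h := hψmul 1 Λ'.one_mem 1 Λ'.one_mem
    rw [mul_one] at h
    exact left_eq_add.mp h
  let f : Λ' →* Multiplicative V :=
    { toFun := fun x => Multiplicative.ofAdd (ψ x)
      map_one' := by simp [hψ1]
      map_mul' := fun a b => by
        rw [← ofAdd_add, ← hψmul a a.2 b b.2]; rfl }
  have hker : f.ker = Q.subgroupOf Λ' := by
    ext x
    rw [MonoidHom.mem_ker, Subgroup.mem_subgroupOf]
    change Multiplicative.ofAdd (ψ x) = 1 ↔ _
    rw [ofAdd_eq_one, hψker x x.2]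
  haveI : Finite (Multiplicative V) := Finite.of_equiv V Multiplicative.ofAdd
  haveI : Finite f.range := inferInstance
  haveI : (Q.subgroupOf Λ').FiniteIndex := by
    rw [← hker]; exact Subgroup.finiteIndex_ker f
  haveI : Q.FiniteIndex := by
    refine ⟨?_⟩
    rw [← Subgroup.relIndex_mul_index hQΛ']
    exact mul_ne_zero (Subgroup.FiniteIndex.index_ne_zero (H := Q.subgroupOf Λ'))
      Subgroup.FiniteIndex.index_ne_zero
  exact Q.isOpen_of_isClosed_of_finiteIndex hclosed

end Topology

end EquivariantUnramifiedDescent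

end Literature.NumberTheory.NumberFields
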